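import Summits.AtomisticToContinuum.Crystallization.Theorems.ChargedEnergyGapChartDialB

/-!
# `ChargedEnergyGap` · the CHART DIAL, part C: P's first lemmas — decomp-a2c lens-3 g37 node «ChartDialCollar»

Node beneath the ATTACK piece `P θ := ChartedChargePricing θ` of the slot-2 split of record
`chargedEnergyGap_iff_pieces (3/20)` (parts A/B, tree).  Lens «one certified translation + split beneath»,
applied to P itself.  Everything here is PROVED (0 sorry); no piece is a rewording of P (probes in the g37 MEMO-P).

§1 `e*`-ELIMINATION (certified translation, EXACT).  `ChartedChargePricing θ ↔ ChartedChargeRepair θ`: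
   P is exactly the existence, for every periodic `Q`, of a periodic REPAIR competitor `Q'` gaining `κ` per
   charted charged site up to the gross debit — the infimum `e*` never has to be known (`bddBelow` + `exists_lt_of_ciInf_lt`).
§2 LOCALISATION.  `#F · e(Q) = ∑_{x ∈ motif} siteEnergy Q x` and `excess Q = ∑_x (siteEnergy Q x − e*)` (definitional).
§3 COLLAR SPLIT (EXACT, every collar radius `R`).  A charted charged site is NEAR (some gross charged site within
   `R · nn` of it, gross-ness read at a motif representative) or FAR; `P θ ↔ FarFieldPricing θ R ∧ CollarPricing θ R`.
   FAR = discrete elasticity of charted matter away from defect cores (the ATTACK proper); COLLAR = packing/stability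
   multiplicity of charted charged sites around a defect core (TRUE-type expected, M).
§4 THE DEFECT-FREE CORE.  `AllChartedPricing θ` (configurations with no gross charged site pay `κ` per charged site)
   is implied by FAR for every `R` and by P; its `e*`-free form `ElasticRepair θ` is equivalent to it.  Its first rung is
   the homogeneous pinch law (census I-ELAS), not typed here.
§5 weakness certificates (each piece is implied by P) and the dial in `R`.
-/

noncomputable section

open Literature.MathematicalPhysics.StatisticalMechanics
open Literature.Geometry.DiscreteGeometry
open Summit.AtomisticToContinuum.Crystallization.Theses.PricedLinkCensus
open Summit.AtomisticToContinuum.Crystallization.Theorems.ChargedEnergyGapNegative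
namespace Summit.AtomisticToContinuum.Crystallization.Theorems.ChargedEnergyGapChartDial

/-! ## §1 `e*`-elimination: pricing = repair -/

/-- **Charted charge REPAIR at tolerance `θ`** (the `e*`-free form of `ChartedChargePricing θ`): every periodic
configuration admits a periodic competitor `Q'` with `κ · #(charted charged) ≤ #F · (e(Q) − e(Q')) + C · #(gross charged)`. -/
def ChartedChargeRepair (θ : ℝ) : Prop :=
  ∃ κ C : ℝ, 0 < κ ∧ 0 ≤ C ∧ ∀ Q : PeriodicConfiguration 3, ∃ Q' : PeriodicConfiguration 3,
    κ * (motifChargedCharted θ Q : ℝ) ≤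
      (Q.motif.card : ℝ) * (Q.energyPerParticle lennardJones - Q'.energyPerParticle lennardJones) +
        C * (motifChargedGross θ Q : ℝ)

/-- A competitor's energy bounds the excess from below: `#F·(e(Q) − e(Q')) ≤ excess Q`. -/
theorem card_mul_sub_le_excess (Q Q' : PeriodicConfiguration 3) :
    (Q.motif.card : ℝ) * (Q.energyPerParticle lennardJones - Q'.energyPerParticle lennardJones) ≤ excess Q :=
  mul_le_mul_of_nonneg_left (sub_le_sub_left (eStar_le Q') _) (Nat.cast_nonneg _)

/-- The infimum trick: if `0 < a ≤ excess Q` then some periodic `Q'` has `a/2 ≤ #F·(e(Q) − e(Q'))`. -/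
theorem exists_competitor_of_le_excess {Q : PeriodicConfiguration 3} {a : ℝ} (ha : 0 < a) (h : a ≤ excess Q) :
    ∃ Q' : PeriodicConfiguration 3,
      a / 2 ≤ (Q.motif.card : ℝ) * (Q.energyPerParticle lennardJones - Q'.energyPerParticle lennardJones) := by
  have hF : (0 : ℝ) < Q.motif.card := by exact_mod_cast Q.motif_nonempty.card_pos
  have hlt : eStar < eStar + a / (2 * Q.motif.card) := lt_add_of_pos_right _ (by positivity)
  obtain ⟨Q', hQ'⟩ := exists_lt_of_ciInf_lt (f := fun Q : PeriodicConfiguration 3 => Q.energyPerParticle lennardJones) hlt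
  refine ⟨Q', ?_⟩
  have h1 : (Q.motif.card : ℝ) * (Q.energyPerParticle lennardJones - Q'.energyPerParticle lennardJones) ≥
      excess Q - (Q.motif.card : ℝ) * (a / (2 * Q.motif.card)) := by
    have : (Q.motif.card : ℝ) * Q'.energyPerParticle lennardJones ≤
        (Q.motif.card : ℝ) * (eStar + a / (2 * Q.motif.card)) := mul_le_mul_of_nonneg_left hQ'.le hF.le
    simp only [excess, mul_sub, mul_add] at this ⊢; linarith
  have h2 : (Q.motif.card : ℝ) * (a / (2 * Q.motif.card)) = a / 2 := by field_simp
  linarith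

/-- **CERTIFIED TRANSLATION (exact)**: `ChartedChargePricing θ ↔ ChartedChargeRepair θ`. -/
theorem chartedChargePricing_iff_repair (θ : ℝ) : ChartedChargePricing θ ↔ ChartedChargeRepair θ := by
  constructor
  · rintro ⟨κ, C, hκ, hC, h⟩
    refine ⟨κ / 2, C, by positivity, hC, fun Q => ?_⟩
    by_cases h0 : motifChargedCharted θ Q = 0
    · exact ⟨Q, by simp [h0]; positivity⟩
    · have hpos : 0 < κ * (motifChargedCharted θ Q : ℝ) := by
        have : (1 : ℝ) ≤ motifChargedCharted θ Q := by exact_mod_cast Nat.one_le_iff_ne_zero.2 h0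
        positivity
      by_cases hle : κ * (motifChargedCharted θ Q : ℝ) - C * (motifChargedGross θ Q : ℝ) ≤ 0
      · refine ⟨Q, ?_⟩; simp only [sub_self, mul_zero, zero_add]; nlinarith
      · push Not at hle
        obtain ⟨Q', hQ'⟩ := exists_competitor_of_le_excess hle (by linarith [h Q])
        exact ⟨Q', by nlinarith [hQ', Nat.cast_nonneg (α := ℝ) (motifChargedGross θ Q)]⟩
  · rintro ⟨κ, C, hκ, hC, h⟩
    refine ⟨κ, C, hκ, hC, fun Q => ?_⟩
    obtain ⟨Q', hQ'⟩ := h Q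
    linarith [card_mul_sub_le_excess Q Q']

/-! ## §2 Localisation: the excess is a sum of site excesses -/

/-- The site (star) energy of a motif site: half the pair sum over the other points of `Q`. -/
def siteEnergy (Q : PeriodicConfiguration 3) (x : E3) : ℝ :=
  2⁻¹ * ∑' y : {y : E3 // y ∈ Q.points ∧ y ≠ x}, lennardJones (dist x y.1)

/-- `#F · e(Q) = ∑_{x ∈ F} siteEnergy Q x` (definitional). -/
theorem card_mul_energyPerParticle (Q : PeriodicConfiguration 3) :
    (Q.motif.card : ℝ) * Q.energyPerParticle lennardJones = ∑ x ∈ Q.motif, siteEnergy Q x := by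
  have hF : (Q.motif.card : ℝ) ≠ 0 := by exact_mod_cast Q.motif_nonempty.card_pos.ne'
  simp only [PeriodicConfiguration.energyPerParticle, siteEnergy, Finset.mul_sum]
  refine Finset.sum_congr rfl fun x _ => ?_
  have h2 : (Q.motif.card : ℝ) * 2⁻¹ * (Q.motif.card : ℝ)⁻¹ = 2⁻¹ := by field_simp
  rw [mul_inv, ← mul_assoc, ← mul_assoc, h2]

/-- `excess Q = ∑_{x ∈ F} (siteEnergy Q x − e*)`. -/
theorem excess_eq_sum (Q : PeriodicConfiguration 3) :
    excess Q = ∑ x ∈ Q.motif, (siteEnergy Q x - eStar) := by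
  simp only [excess, Finset.sum_sub_distrib, Finset.sum_const, nsmul_eq_mul, mul_sub, card_mul_energyPerParticle]

/-! ## §3 The collar split -/

/-- `p` is **near a defect core** at collar radius `R`: some GROSS CHARGED site (charge and chart read at its motif
representative `y`) has a lattice translate within `R · nn(p)` of `p`. -/
def NearGross (θ R : ℝ) (Q : PeriodicConfiguration 3) (p : Q.points) : Prop :=
  ∃ y : Q.motif, ∃ g ∈ Q.lattice, Charged Q y ∧ ¬ ChartedAt θ Q (pt Q y) ∧
    dist (p : E3) ((y : E3) + g) ≤ R * nn Q p

/-- charted charged motif sites NEAR a defect core. -/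
def motifCCNear (θ R : ℝ) (Q : PeriodicConfiguration 3) : ℕ :=
  Nat.card {x : Q.motif // (Charged Q x ∧ ChartedAt θ Q (pt Q x)) ∧ NearGross θ R Q (pt Q x)}

/-- charted charged motif sites FAR from every defect core. -/
def motifCCFar (θ R : ℝ) (Q : PeriodicConfiguration 3) : ℕ :=
  Nat.card {x : Q.motif // (Charged Q x ∧ ChartedAt θ Q (pt Q x)) ∧ ¬ NearGross θ R Q (pt Q x)}

/-- `#charted charged = #far + #near`. -/
theorem motifChargedCharted_eq_far_add_near (θ R : ℝ) (Q : PeriodicConfiguration 3) :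
    motifChargedCharted θ Q = motifCCFar θ R Q + motifCCNear θ R Q :=
  natCard_subtype_split (fun x : Q.motif => Charged Q x ∧ ChartedAt θ Q (pt Q x)) (fun x => NearGross θ R Q (pt Q x))

/-- piece FAR · WEAKER(proved `farFieldPricing_of_chartedChargePricing`) · ATTACK (discrete nonlinear elasticity of
charted close-packed matter away from defect cores; inputs K `HarmonicPolytypeStability`, R chart straightening, bond
Taylor ledger, I-ELAS certificates; defect-free core `AllChartedPricing`, first rung the pinch law).
**Far-field pricing**: `κ` per charted charged site with no gross charged site within `R · nn`, gross debit `C`. -/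
def FarFieldPricing (θ R : ℝ) : Prop :=
  ∃ κ C : ℝ, 0 < κ ∧ 0 ≤ C ∧ ∀ Q : PeriodicConfiguration 3,
    κ * (motifCCFar θ R Q : ℝ) ≤ excess Q + C * (motifChargedGross θ Q : ℝ)

/-- piece COLLAR · WEAKER(proved `collarPricing_of_chartedChargePricing`) · TRUE-type expected · M (packing + LJ
stability: boundedly many charted charged sites of comparable scale per defect core, smaller-scale ones pay by repulsion).
**Collar pricing**: `κ` per charted charged site within `R · nn` of a gross charged site, gross debit `C`. -/
def CollarPricing (θ R : ℝ) : Prop :=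
  ∃ κ C : ℝ, 0 < κ ∧ 0 ≤ C ∧ ∀ Q : PeriodicConfiguration 3,
    κ * (motifCCNear θ R Q : ℝ) ≤ excess Q + C * (motifChargedGross θ Q : ℝ)

/-- **GLUE**: FAR and COLLAR give P with `κ = min κ₁ κ₂ / 2`… (here: `κ₁κ₂/(κ₁+κ₂)`-free bookkeeping via `min`). -/
theorem chartedChargePricing_of_far_collar {θ R : ℝ} (hF : FarFieldPricing θ R) (hN : CollarPricing θ R) :
    ChartedChargePricing θ := by
  obtain ⟨κ₁, C₁, hκ₁, hC₁, h₁⟩ := hF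
  obtain ⟨κ₂, C₂, hκ₂, hC₂, h₂⟩ := hN
  refine ⟨min κ₁ κ₂ / 2, C₁ + C₂, by positivity, by positivity, fun Q => ?_⟩
  have e := motifChargedCharted_eq_far_add_near θ R Q
  have hc : (motifChargedCharted θ Q : ℝ) = motifCCFar θ R Q + motifCCNear θ R Q := by exact_mod_cast e
  have a₁ := h₁ Q; have a₂ := h₂ Q
  have m₁ : min κ₁ κ₂ ≤ κ₁ := min_le_left _ _
  have m₂ : min κ₁ κ₂ ≤ κ₂ := min_le_right _ _
  have f0 : (0 : ℝ) ≤ motifCCFar θ R Q := Nat.cast_nonneg _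
  have n0 : (0 : ℝ) ≤ motifCCNear θ R Q := Nat.cast_nonneg _
  have g0 : (0 : ℝ) ≤ motifChargedGross θ Q := Nat.cast_nonneg _
  have x0 := excess_nonneg' Q
  rw [hc]
  nlinarith [mul_le_mul_of_nonneg_right m₁ f0, mul_le_mul_of_nonneg_right m₂ n0]

/-- FAR is implied by P (it prices a subset). -/
theorem farFieldPricing_of_chartedChargePricing {θ : ℝ} (R : ℝ) (hP : ChartedChargePricing θ) :
    FarFieldPricing θ R := by
  obtain ⟨κ, C, hκ, hC, h⟩ := hP
  refine ⟨κ, C, hκ, hC, fun Q => le_trans ?_ (h Q)⟩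
  have : (motifCCFar θ R Q : ℝ) ≤ motifChargedCharted θ Q := by
    exact_mod_cast (motifChargedCharted_eq_far_add_near θ R Q).symm ▸ Nat.le_add_right _ _
  exact mul_le_mul_of_nonneg_left this hκ.le

/-- COLLAR is implied by P (it prices a subset). -/
theorem collarPricing_of_chartedChargePricing {θ : ℝ} (R : ℝ) (hP : ChartedChargePricing θ) :
    CollarPricing θ R := by
  obtain ⟨κ, C, hκ, hC, h⟩ := hP
  refine ⟨κ, C, hκ, hC, fun Q => le_trans ?_ (h Q)⟩
  have : (motifCCNear θ R Q : ℝ) ≤ motifChargedCharted θ Q := by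
    exact_mod_cast (motifChargedCharted_eq_far_add_near θ R Q).symm ▸ Nat.le_add_left _ _
  exact mul_le_mul_of_nonneg_left this hκ.le

/-- **EXACT SPLIT** (every collar radius `R`): `P θ ↔ FAR θ R ∧ COLLAR θ R`. -/
theorem chartedChargePricing_iff_far_collar (θ R : ℝ) :
    ChartedChargePricing θ ↔ FarFieldPricing θ R ∧ CollarPricing θ R :=
  ⟨fun h => ⟨farFieldPricing_of_chartedChargePricing R h, collarPricing_of_chartedChargePricing R h⟩,
    fun h => chartedChargePricing_of_far_collar h.1 h.2⟩

/-! ## §4 The defect-free core -/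

/-- core · WEAKER than FAR (every `R`) and than P · ATTACK's first target (pure elasticity, no defect at all):
**all-charted pricing** — a periodic configuration without gross charged sites pays `κ` per charged site above `e*`. -/
def AllChartedPricing (θ : ℝ) : Prop :=
  ∃ κ : ℝ, 0 < κ ∧ ∀ Q : PeriodicConfiguration 3, motifChargedGross θ Q = 0 →
    κ * (motifCharged (1 / 100) Q : ℝ) ≤ excess Q

/-- Its `e*`-free form: **elastic repair** — such a configuration has a periodic competitor gaining `κ` per charged site. -/
def ElasticRepair (θ : ℝ) : Prop :=
  ∃ κ : ℝ, 0 < κ ∧ ∀ Q : PeriodicConfiguration 3, motifChargedGross θ Q = 0 → ∃ Q' : PeriodicConfiguration 3,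
    κ * (motifCharged (1 / 100) Q : ℝ) ≤
      (Q.motif.card : ℝ) * (Q.energyPerParticle lennardJones - Q'.energyPerParticle lennardJones)

/-- Without gross charged sites nothing is near a defect core. -/
theorem not_nearGross_of_gross_eq_zero {θ R : ℝ} {Q : PeriodicConfiguration 3} (h0 : motifChargedGross θ Q = 0)
    (p : Q.points) : ¬ NearGross θ R Q p := by
  rintro ⟨y, g, -, hy, hy', -⟩
  have : Nat.card {x : Q.motif // Charged Q x ∧ ¬ ChartedAt θ Q (pt Q x)} ≠ 0 := by
    rw [Nat.card_ne_zero]; exact ⟨⟨⟨y, hy, hy'⟩⟩, inferInstance⟩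
  exact this h0

/-- Without gross charged sites, every charged site is a far charted charged site. -/
theorem motifCCFar_eq_of_gross_eq_zero {θ : ℝ} (R : ℝ) {Q : PeriodicConfiguration 3} (h0 : motifChargedGross θ Q = 0) :
    motifCCFar θ R Q = motifCharged (1 / 100) Q := by
  have h1 : motifCCNear θ R Q = 0 := by
    rw [motifCCNear, Nat.card_eq_zero]; left
    exact ⟨fun x => not_nearGross_of_gross_eq_zero h0 _ x.2.2⟩
  have h2 := motifChargedCharted_eq_far_add_near θ R Q
  have h3 := motifCharged_eq_add θ Q
  omega

/-- FAR (any `R`) implies the defect-free core. -/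
theorem allChartedPricing_of_farFieldPricing {θ R : ℝ} (hF : FarFieldPricing θ R) : AllChartedPricing θ := by
  obtain ⟨κ, C, hκ, -, h⟩ := hF
  refine ⟨κ, hκ, fun Q h0 => ?_⟩
  have := h Q
  rw [motifCCFar_eq_of_gross_eq_zero R h0, h0] at this
  simpa using this

/-- P implies the defect-free core. -/
theorem allChartedPricing_of_chartedChargePricing {θ : ℝ} (hP : ChartedChargePricing θ) : AllChartedPricing θ :=
  allChartedPricing_of_farFieldPricing (farFieldPricing_of_chartedChargePricing 0 hP)

/-- **`e*`-elimination for the core (exact)**: `AllChartedPricing θ ↔ ElasticRepair θ`. -/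
theorem allChartedPricing_iff_elasticRepair (θ : ℝ) : AllChartedPricing θ ↔ ElasticRepair θ := by
  constructor
  · rintro ⟨κ, hκ, h⟩
    refine ⟨κ / 2, by positivity, fun Q h0 => ?_⟩
    by_cases hc : motifCharged (1 / 100) Q = 0
    · exact ⟨Q, by rw [hc, sub_self, mul_zero, Nat.cast_zero, mul_zero]⟩
    · have hpos : 0 < κ * (motifCharged (1 / 100) Q : ℝ) := by
        have : (1 : ℝ) ≤ motifCharged (1 / 100) Q := by exact_mod_cast Nat.one_le_iff_ne_zero.2 hc
        positivity
      obtain ⟨Q', hQ'⟩ := exists_competitor_of_le_excess hpos (h Q h0)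
      exact ⟨Q', by linarith⟩
  · rintro ⟨κ, hκ, h⟩
    refine ⟨κ, hκ, fun Q h0 => ?_⟩
    obtain ⟨Q', hQ'⟩ := h Q h0
    linarith [card_mul_sub_le_excess Q Q']

/-! ## §5 The dial in `R` (FAR shrinks, COLLAR grows with `R`) -/

/-- Nearness is monotone in the collar radius. -/
theorem nearGross_mono {θ R R' : ℝ} (h : R ≤ R') {Q : PeriodicConfiguration 3} {p : Q.points}
    (hp : NearGross θ R Q p) : NearGross θ R' Q p := by
  obtain ⟨y, g, hg, hy, hy', hd⟩ := hp
  exact ⟨y, g, hg, hy, hy', hd.trans (mul_le_mul_of_nonneg_right h (nearestDist_nonneg _ _))⟩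

/-- FAR is antitone in `R`: a larger collar leaves fewer far sites to price. -/
theorem farFieldPricing_anti {θ R R' : ℝ} (h : R ≤ R') (hF : FarFieldPricing θ R) : FarFieldPricing θ R' := by
  obtain ⟨κ, C, hκ, hC, hQ⟩ := hF
  refine ⟨κ, C, hκ, hC, fun Q => le_trans (mul_le_mul_of_nonneg_left ?_ hκ.le) (hQ Q)⟩
  exact_mod_cast Nat.card_le_card_of_injective
    (fun x : {x : Q.motif // (Charged Q x ∧ ChartedAt θ Q (pt Q x)) ∧ ¬ NearGross θ R' Q (pt Q x)} =>
      (⟨x.1, x.2.1, fun hn => x.2.2 (nearGross_mono h hn)⟩ :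
        {x : Q.motif // (Charged Q x ∧ ChartedAt θ Q (pt Q x)) ∧ ¬ NearGross θ R Q (pt Q x)}))
    (fun a b hab => Subtype.ext (by simpa using congrArg Subtype.val hab))

/-- COLLAR is monotone in `R` the other way: a smaller collar has fewer near sites to price. -/
theorem collarPricing_mono {θ R R' : ℝ} (h : R ≤ R') (hN : CollarPricing θ R') : CollarPricing θ R := by
  obtain ⟨κ, C, hκ, hC, hQ⟩ := hN
  refine ⟨κ, C, hκ, hC, fun Q => le_trans (mul_le_mul_of_nonneg_left ?_ hκ.le) (hQ Q)⟩
  exact_mod_cast Nat.card_le_card_of_injective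
    (fun x : {x : Q.motif // (Charged Q x ∧ ChartedAt θ Q (pt Q x)) ∧ NearGross θ R Q (pt Q x)} =>
      (⟨x.1, x.2.1, nearGross_mono h x.2.2⟩ :
        {x : Q.motif // (Charged Q x ∧ ChartedAt θ Q (pt Q x)) ∧ NearGross θ R' Q (pt Q x)}))
    (fun a b hab => Subtype.ext (by simpa using congrArg Subtype.val hab))

/-- The `R`-dial's trivial end: at collar radius `R < 0` nothing is near (distances are non-negative; stated under the
own-scale positivity `0 < nn`, which periodic point sets have), so COLLAR is free there and FAR is all of P. -/
theorem collarPricing_of_neg {θ R : ℝ} (hR : R < 0) (hnn : ∀ (Q : PeriodicConfiguration 3) (p : Q.points), 0 < nn Q p) :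
    CollarPricing θ R := by
  refine ⟨1, 0, one_pos, le_rfl, fun Q => ?_⟩
  have h1 : motifCCNear θ R Q = 0 := by
    rw [motifCCNear, Nat.card_eq_zero]; left
    refine ⟨fun x => ?_⟩
    obtain ⟨y, g, -, -, -, hd⟩ := x.2.2
    have : R * nn Q (pt Q x.1) < 0 := mul_neg_of_neg_of_pos hR (hnn Q _)
    exact absurd (hd.trans_lt this) (not_lt.2 dist_nonneg)
  simp [h1, excess_nonneg' Q]

end Summit.AtomisticToContinuum.Crystallization.Theorems.ChargedEnergyGapChartDial

end
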